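import Mathlib
import HarnessLib
import Summits.HubbardSuperconductivity.HubbardSuperconductivity.Theorems.KLProgrammeKLRegimeTwoVolumeTowerTruncCloserLevS
import Summits.HubbardSuperconductivity.HubbardSuperconductivity.Theorems.KLProgrammeKLRegimeTwoVolumeTowerEpsDoors

/-!
# Route `KLProgramme` — crux K3, VL child `KLRegimeVolumeLimitV17F2` (stmt-HubbardSuperconductivity-20440), skeleton «cauchy» v11: `stub_vl_towerData` FROM THE
# PRODUCER TEXT AND ONE SUPPLIERS' HYPOTHESIS — the quantifier threading and the `c₅/U₀` doors (seat hubbard-kl-k3c4-p1 g15; `--supports` 20440)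

The registered data stub reads `(producer text) → ∀ G P Q R (WF) → ∃ c₅ → ∀ c ≤ c₅ → ∃ U₀ → ∀ μ U β (regime) K (frameOK) Lstar Mstar (TowerP) →
∃ t ∈ (0,1], Nonempty (TowerDataTS β U μ t)`.  This file performs everything that is NOT a supplier's mathematics: it instantiates the producer text at
`(P, R₁)`, `R₁ = ⟨1,1,1⟩` (as the landed door p621429 does), obtains the `ε`-doors of `…TowerEpsDoors.exists_doors_towerEps` for the suppliers' scale-free sizes
`(k₀, B₂, B₃, W)`, takes `c₅ := min`, `U₀ := min`, and hands the producer's `A, L₁, M₁` and the four `ε`-inequalities (every `j ≤ n_β`) to ONE suppliers'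
hypothesis `hSup` — whose discharge is `…TowerDataTSExists.exists_towerDataTS_of_readouts` once the suppliers' files land (ASSEMBLY-DESIGN-g15 §4; the sizes
`B₂ = 8·CE·D_q`, `B₃ = 8·CE′·D_q`, `W = 256e²(a₀+cR₀+cC₀+1)(42cW₀+4δb₀+8e)·K` are the suppliers' to name, which is why `hSup` produces them after seeing `Q′`).

* **`stub_vl_towerData_of_suppliers`** — `(hSup) → (producer text) → (conclusion of stub_vl_towerData, v11)`.

Proofs only; no definition.  Honest framing: conditional threading; nothing here asserts the producer text, `hSup`, the stub, K3 or superconductivity.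
[cite: BenfattoGiulianiMastropietro2006, §2.7-§2.9 and §3]
-/

noncomputable section

namespace Summit.HubbardSuperconductivity.HubbardSuperconductivity.Theorems.TwoVolumeSource

set_option linter.dupNamespace false -- summit = problem name (single-conjunct summit), D-0017

open Finset Filter Topology Literature.MathematicalPhysics.QuantumLattice GrassmannAlgebra Literature.Probability.LatticeModels
  Literature.Probability.LatticeModels.BattleFederbush
open Summit.HubbardSuperconductivity.HubbardSuperconductivity.Theorems.TwoPointAssembly
open Summit.HubbardSuperconductivity.HubbardSuperconductivity.Theorems.KLRegimeSplit
open Summit.HubbardSuperconductivity.HubbardSuperconductivity.Theorems.KLProgrammeLegKernels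
open Summit.HubbardSuperconductivity.HubbardSuperconductivity.Theorems.EngineV8
open Summit.HubbardSuperconductivity.HubbardSuperconductivity.Theorems.TwoVolumeDefect

/-- **`stub_vl_towerData` (v11) FROM THE PRODUCER TEXT AND ONE SUPPLIERS' HYPOTHESIS** (see the module docstring).
[folklore: quantifier threading; cite: BenfattoGiulianiMastropietro2006, §2.7-§2.9 and §3] -/
theorem stub_vl_towerData_of_suppliers
    (hSup : ∀ (G : GeoConsts) (P : SplitConsts) (Q : EngConsts) (R : RenConsts) (Q' : EngConsts), G.WF → P.WF → Q.WF → R.WF → 0 ≤ Q'.CE →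
      ∃ (k₀ B₂ B₃ W : ℝ), 0 < k₀ ∧ 0 ≤ B₂ ∧ 0 ≤ B₃ ∧ 0 ≤ W ∧
        ∀ c : ℝ, 0 < c → ∀ μ ∈ klWindowC, ∀ U : ℝ, 0 < U → ∀ β : ℝ, klBetaMin ≤ β → β ≤ Real.exp (c / U ^ 2) →
          ∀ K : TrigPolyC4v, klPredsV17F2.frameOK R U (nScales β) μ K →
            ∀ (Lstar : ℕ) (Mstar : ℕ → ℕ), TowerP klPredsV17F2 G P Q R β U μ K Lstar Mstar →
              (∀ j, j ≤ nScales β → 0 < epsCoupling P U (j + 1) ∧ epsCoupling P U (j + 1) ≤ 1 ∧ B₂ * epsCoupling P U (j + 1) ≤ 1 ∧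
                B₃ * epsCoupling P U (j + 1) ≤ 1 ∧ epsCoupling P U (j + 1) * W ≤ k₀ ^ 2) →
              ∀ (A : ℕ → ℕ → ℝ) (L₁ : ℕ) (M₁ : ℕ → ℕ),
                (∀ (L M : ℕ) [NeZero L] [NeZero M], L₁ ≤ L → M₁ L ≤ M → ∀ j : ℕ, j + 1 ≤ nScales β + 1 →
                  SourceProfilesAtLev L M (klSrcBudget P Q' U A (j + 1)) β U μ (klFlowFrameU L M β U μ (nScales β + 1)) j j (j + 1)) →
                ∃ t : ℝ, 0 < t ∧ t ≤ 1 ∧ Nonempty (TowerDataTS β U μ t)) :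
    (∀ (P : SplitConsts) (R : RenConsts), P.WF → R.WF2 →
      ∃ Q' : EngConsts, 0 ≤ Q'.CE ∧ ∃ c₀ : ℝ, 0 < c₀ ∧ ∀ c : ℝ, 0 < c → c ≤ c₀ → ∃ U₀ : ℝ, 0 < U₀ ∧
        ∀ μ ∈ klWindowC, ∀ U : ℝ, 0 < U → U ≤ U₀ → ∀ β : ℝ, klBetaMin ≤ β → β ≤ Real.exp (c / U ^ 2) →
          ∃ A : ℕ → ℕ → ℝ, ∃ L₁ : ℕ, ∃ M₁ : ℕ → ℕ, ∀ (L M : ℕ) [NeZero L] [NeZero M], L₁ ≤ L → M₁ L ≤ M →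
            ∀ j : ℕ, j + 1 ≤ nScales β + 1 →
              SourceProfilesAtLev L M (klSrcBudget P Q' U A (j + 1)) β U μ (klFlowFrameU L M β U μ (nScales β + 1)) j j (j + 1)) →
    ∀ (G : GeoConsts) (P : SplitConsts) (Q : EngConsts) (R : RenConsts), G.WF → P.WF → Q.WF → R.WF →
      ∃ c₅ : ℝ, 0 < c₅ ∧ ∀ c : ℝ, 0 < c → c ≤ c₅ → ∃ U₀ : ℝ, 0 < U₀ ∧
        ∀ μ ∈ klWindowC, ∀ U : ℝ, 0 < U → U ≤ U₀ → ∀ β : ℝ, klBetaMin ≤ β → β ≤ Real.exp (c / U ^ 2) →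
          ∀ K : TrigPolyC4v, klPredsV17F2.frameOK R U (nScales β) μ K →
            ∀ (Lstar : ℕ) (Mstar : ℕ → ℕ), TowerP klPredsV17F2 G P Q R β U μ K Lstar Mstar →
              ∃ t : ℝ, 0 < t ∧ t ≤ 1 ∧ Nonempty (TowerDataTS β U μ t) := by
  intro hSrc G P Q R hG hP hQ hR
  -- the producer text at `(P, R₁)`
  have hR₁ : (⟨1, 1, fun _ => 1⟩ : RenConsts).WF2 := ⟨⟨zero_le_one, zero_le_one, fun _ => zero_le_one⟩, one_pos, one_pos⟩
  obtain ⟨Q', hQ'CE, c₀, hc₀, hS⟩ := hSrc P ⟨1, 1, fun _ => 1⟩ hP hR₁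
  -- the suppliers' sizes and the `ε`-doors
  have hKl : 0 < P.Klam := lt_of_lt_of_le one_pos hP.1
  obtain ⟨k₀, B₂, B₃, W, hk₀, hB₂, hB₃, hW, hsup⟩ := hSup G P Q R Q' hG hP hQ hR hQ'CE
  obtain ⟨c₅, hc₅, U₅, hU₅, hdoors⟩ := exists_doors_towerEps hKl hB₂ hB₃ hW hk₀
  refine ⟨min c₅ c₀, lt_min hc₅ hc₀, fun c hc0 hcc => ?_⟩
  obtain ⟨U₀, hU₀, hS2⟩ := hS c hc0 (hcc.trans (min_le_right _ _))
  refine ⟨min U₅ U₀, lt_min hU₅ hU₀, fun μ hμ U hU0 hUU β hβmin hβmax K hK Lstar Mstar hT => ?_⟩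
  obtain ⟨A, L₁, M₁, hA⟩ := hS2 μ hμ U hU0 (hUU.trans (min_le_right _ _)) β hβmin hβmax
  have hUabs : |U| ≤ U₅ := by rw [abs_of_pos hU0]; exact hUU.trans (min_le_left _ _)
  exact hsup c hc0 μ hμ U hU0 β hβmin hβmax K hK Lstar Mstar hT
    (fun j hj => hdoors c hc0.le (hcc.trans (min_le_left _ _)) U hU0.ne' hUabs β hβmin hβmax j hj) A L₁ M₁ hA

/-- `klSrcBudget` is monotone in the degree-`≤ 2` budgets `A` (the degree law is nonnegative). [folklore] -/
theorem klSrcBudget_mono_A (P : SplitConsts) (Q' : EngConsts) (U : ℝ) {A A' : ℕ → ℕ → ℝ} (hCE : 0 ≤ Q'.CE) (hK : 0 ≤ P.Klam)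
    (h : ∀ j s, A j s ≤ A' j s) (j s m : ℕ) : klSrcBudget P Q' U A j s m ≤ klSrcBudget P Q' U A' j s m := by
  unfold klSrcBudget
  refine mul_le_mul_of_nonneg_right (h j s) ?_
  split_ifs
  · exact zero_le_one
  · exact klWtBudget_nonneg hCE hK U j m

/-- **`stub_vl_towerData` (v11) with the producer's budgets made NONNEGATIVE** (`A ↦ A⁺ := max A 0`; `SourceProfilesAtLev.mono`): the suppliers' hypothesis
may assume `0 ≤ A j s` — exactly the `hA` of `…TowerDataTSExists.exists_towerDataTS_of_readouts`. [folklore: quantifier threading;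
cite: BenfattoGiulianiMastropietro2006, §2.7-§2.9 and §3] -/
theorem stub_vl_towerData_of_suppliers_pos
    (hSup : ∀ (G : GeoConsts) (P : SplitConsts) (Q : EngConsts) (R : RenConsts) (Q' : EngConsts), G.WF → P.WF → Q.WF → R.WF → 0 ≤ Q'.CE →
      ∃ (k₀ B₂ B₃ W : ℝ), 0 < k₀ ∧ 0 ≤ B₂ ∧ 0 ≤ B₃ ∧ 0 ≤ W ∧
        ∀ c : ℝ, 0 < c → ∀ μ ∈ klWindowC, ∀ U : ℝ, 0 < U → ∀ β : ℝ, klBetaMin ≤ β → β ≤ Real.exp (c / U ^ 2) →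
          ∀ K : TrigPolyC4v, klPredsV17F2.frameOK R U (nScales β) μ K →
            ∀ (Lstar : ℕ) (Mstar : ℕ → ℕ), TowerP klPredsV17F2 G P Q R β U μ K Lstar Mstar →
              (∀ j, j ≤ nScales β → 0 < epsCoupling P U (j + 1) ∧ epsCoupling P U (j + 1) ≤ 1 ∧ B₂ * epsCoupling P U (j + 1) ≤ 1 ∧
                B₃ * epsCoupling P U (j + 1) ≤ 1 ∧ epsCoupling P U (j + 1) * W ≤ k₀ ^ 2) →
              ∀ (A : ℕ → ℕ → ℝ) (L₁ : ℕ) (M₁ : ℕ → ℕ), (∀ j s, 0 ≤ A j s) →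
                (∀ (L M : ℕ) [NeZero L] [NeZero M], L₁ ≤ L → M₁ L ≤ M → ∀ j : ℕ, j + 1 ≤ nScales β + 1 →
                  SourceProfilesAtLev L M (klSrcBudget P Q' U A (j + 1)) β U μ (klFlowFrameU L M β U μ (nScales β + 1)) j j (j + 1)) →
                ∃ t : ℝ, 0 < t ∧ t ≤ 1 ∧ Nonempty (TowerDataTS β U μ t)) :
    (∀ (P : SplitConsts) (R : RenConsts), P.WF → R.WF2 →
      ∃ Q' : EngConsts, 0 ≤ Q'.CE ∧ ∃ c₀ : ℝ, 0 < c₀ ∧ ∀ c : ℝ, 0 < c → c ≤ c₀ → ∃ U₀ : ℝ, 0 < U₀ ∧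
        ∀ μ ∈ klWindowC, ∀ U : ℝ, 0 < U → U ≤ U₀ → ∀ β : ℝ, klBetaMin ≤ β → β ≤ Real.exp (c / U ^ 2) →
          ∃ A : ℕ → ℕ → ℝ, ∃ L₁ : ℕ, ∃ M₁ : ℕ → ℕ, ∀ (L M : ℕ) [NeZero L] [NeZero M], L₁ ≤ L → M₁ L ≤ M →
            ∀ j : ℕ, j + 1 ≤ nScales β + 1 →
              SourceProfilesAtLev L M (klSrcBudget P Q' U A (j + 1)) β U μ (klFlowFrameU L M β U μ (nScales β + 1)) j j (j + 1)) →
    ∀ (G : GeoConsts) (P : SplitConsts) (Q : EngConsts) (R : RenConsts), G.WF → P.WF → Q.WF → R.WF →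
      ∃ c₅ : ℝ, 0 < c₅ ∧ ∀ c : ℝ, 0 < c → c ≤ c₅ → ∃ U₀ : ℝ, 0 < U₀ ∧
        ∀ μ ∈ klWindowC, ∀ U : ℝ, 0 < U → U ≤ U₀ → ∀ β : ℝ, klBetaMin ≤ β → β ≤ Real.exp (c / U ^ 2) →
          ∀ K : TrigPolyC4v, klPredsV17F2.frameOK R U (nScales β) μ K →
            ∀ (Lstar : ℕ) (Mstar : ℕ → ℕ), TowerP klPredsV17F2 G P Q R β U μ K Lstar Mstar →
              ∃ t : ℝ, 0 < t ∧ t ≤ 1 ∧ Nonempty (TowerDataTS β U μ t) := by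
  refine stub_vl_towerData_of_suppliers fun G P Q R Q' hG hP hQ hR hQ'CE => ?_
  obtain ⟨k₀, B₂, B₃, W, hk₀, hB₂, hB₃, hW, hsup⟩ := hSup G P Q R Q' hG hP hQ hR hQ'CE
  refine ⟨k₀, B₂, B₃, W, hk₀, hB₂, hB₃, hW, fun c hc0 μ hμ U hU0 β hβmin hβmax K hK Lstar Mstar hT heps A L₁ M₁ hA => ?_⟩
  -- replace `A` by `A⁺ = max A 0`
  have hKl : 0 ≤ P.Klam := le_trans zero_le_one hP.1
  refine hsup c hc0 μ hμ U hU0 β hβmin hβmax K hK Lstar Mstar hT heps (fun j s => max (A j s) 0) L₁ M₁ (fun j s => le_max_right _ _) ?_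
  intro L M _ _ hL hM j hj
  exact (hA L M hL hM j hj).mono fun s m => klSrcBudget_mono_A P Q' U hQ'CE hKl (fun j s => le_max_left _ _) (j + 1) s m

end Summit.HubbardSuperconductivity.HubbardSuperconductivity.Theorems.TwoVolumeSource

end
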